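import Summits.QuantumFields.BalabanUV.Beta.SymRootedT2JetAdditive
import Summits.QuantumFields.BalabanUV.Beta.SymWardSiteToBlock
import Summits.QuantumFields.BalabanUV.Beta.SymAveragingMixedJetTables
import Summits.QuantumFields.BalabanUV.Beta.SymAveragingHessianCounts
import Summits.QuantumFields.BalabanUV.Beta.BorderWardSiteLaw

/-!
# `BalabanUV.Beta.SymBorderWardSiteLaw` — THE SITE-LEVEL BORDER WARD LAW (W2-B)_sym OF THE (0.4)-SYMMETRISED BORDER TABLE IS A THEOREM; ITS BOND-LEVEL
# BLOCK SUM `hWb`_sym AT lockB `cB = −Lc¹²∕4`, ROOT `ctr 4 Lc`, `Lc` ODD (β sub-cell, row D1, TABLES-SYM-LEAN S2c∕S2d, TABLE∕KERNEL-LEVEL twin of the row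
# owner's BW-1 `BorderWardSiteLaw`; an1 gen 43; the border WARD path toward the sym root's (T2-B) letters)

HONEST FRAMING (cell charter, verbatim): «discharging BetaPertH makes Bałaban's UV stability UNCONDITIONAL — a real
constructive-QFT result; it is NOT the continuum limit and NOT the Clay problem.»  HONEST DEPENDENCY (verbatim): «continuum YM on
T⁴ ⇐ BetaPertH ∧ nine spine estimates (0/9 proved); BetaPertH ⇐ (D1) ∧ (D4) ∧ CAP+tail; G-an2-4 gates asym, D1 and NE2/3/4.»
ABSOLUTE RULE (R-g25-7 ∕ R-D1-g30-1 (A)): the (0.4)-symmetrised averaging is the exp of the MEAN OF LOGS over the pair family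
`{loop^{σ,σ′}}` with weight `((d!)²·L^d)⁻¹`; every object below is the comb module's algebra read on an1's `symPhiGAt` (S2b part 1)
instead of `PhiGAt` — STATEMENT FOR STATEMENT under the dictionary `PhiXAt ↦ symPhiXAt`, `XjetAt ↦ symXjetAt`, `MσXAt ↦ symMσXAt`,
`L^{-d}·linAvgAt ↦ (d!·L^d)⁻¹·symLinU`, `L^{-d}·hessUAt ↦ ((d!)²L^d)⁻¹·symHessUAt`, `L^{-2d}·vhUAt ↦ ((d!)²L^{2d})⁻¹·symVhUAt`
(an3-g63 [AN3-G63-S2C] (C-ii): constants PER BCH ORDER; CONVENTION `(d!)²` un-normalised inside order-2 sym functionals).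
FAMILY-INDEPENDENT chart ∕ letter ∕ `Tau`-algebra lemmas of the comb module are imported BY NAME, never re-proved.
DERIVED cell leaf: [folklore] ring algebra; the `sym*` families are [our object]s.  No statement of Bałaban's papers is typed here, no
`[cite:]` tag, no `Prop` is minted, no binder of the β-function wall (`hW`/`hR`/`D1Tel`/`D1Rep`, (D1), `BetaPertH`) is instantiated or
discharged; nothing about the VALUES of `symMixFFAt`∕`symVh₂SAt` and no (T2-B)∕(T2-M₂) letter is discharged in this file.
NOT D1, NOT BetaPertH, NOT continuum, NOT Clay.  NOT summit progress.
Provenance: β sub-cell, TABLES-SYM-LEAN S2c option (C) (S2C-SCOPE-v1 94facb80ac685517), unit b2b-balaban-beta-an1-g43 (W-supplier AN1,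
FREEZE (0): scratch for a courier; an1 files nothing), 2026-08-21; no existing file touched.

## What this module proves (sym twin of `BorderWardSiteLaw` §2–§4's `siteWardB`∕`bondWardB`; §1's `βfar_single comm_smul_left ent_B2` are letter∕`UT` algebra,
## the comb module's BY NAME; §4's corollaries for the COMB literal `JsRowD1Pin` are NOT twinned)
* §2 **`symVh2Tab_siteWard₁`, `symVh2Tab_siteWard₂`** — the two single-assignment site laws of the sym border table (an1's `SymBorderJetWard.symT2At_gauge` at
  `λ = δ_u`; the LANDED `symVhUAt_single`; an1's `SymRootedT2JetAdditive.symT2At_sum_B ∕ _sub_B`), constant `(2L^{2d})⁻¹ ↦ (2(d!)²L^{2d})⁻¹`.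
* §3 **`symVh2KerAt_siteWard`** — (W2-B)_sym in kernel currency, general `d`, any root `ρ`, `L ≠ 0`: the ½-symmetrisation of the two laws is
  `symVhKerAt(f,h)·([u = L•y+ρ] − [u = x_f])` — the SAME outer shape as the comb law (`symVhKerAt = symVhCountAt ∕ (2(d!)²L^{2d})`).
* §4 **`symSiteWardB`** (`d = 4`, root `ctr 4 Lc`: the hypothesis of an1's `SymWardSiteToBlock.symBondWardB_of_symSiteWardB` token for token) and **`symBondWardB`**
  (`Lc` odd) = the border Ward bond identity at lockB for the sym kernels.
-/

open Finset
open scoped BigOperators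
open Literature.MathematicalPhysics.QuantumFieldTheory.Balaban1983to89
open Literature.MathematicalPhysics.QuantumFieldTheory.Balaban1983to89.Beta
open scoped Nat
open AffineAveraging (Form1 Site box toSite)
open AveragingContours (blk off)
open AveragingContoursRooted (ctr ctrOff)
open AveragingHessianKernels (Bond single single_apply)
open Summit.QuantumFields.BalabanUV.Beta.SymAveragingHessianCounts (symVhUAt symVhCountAt symVhUAt_single symVhKerAt symLinKerAt symHessKerAt)
open AveragingThirdJet (upF)
open AveragingMixedJetTables (UT E)
open Summit.QuantumFields.BalabanUV.Beta.SymAveragingMixedJetTables (symT2At symT2At_symm symVh2Tab symVh2KerAt symMixKerAt)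
open ExpKernelCalculus (MKer)
open PolarizationSign (reflSign WardTransversal AxisReflectionCovariant)
open ResolventReflection (bref)
open OneStepResolventKernel (Fib JetData)
open OneStepKernelFamily (TbalOf flipK)
open BalabanStepJetsSucc (wVH)
open Summit.QuantumFields.BalabanUV.Beta.BorderedHessian (stepScale)
open Summit.QuantumFields.BalabanUV.Beta.RowD1JointEnd (JsRowD1Pin)
open Summit.QuantumFields.BalabanUV.Beta.MixedJetWard (βg1)
open Summit.QuantumFields.BalabanUV.Beta.MixedJetWardSingle (βg1_single)
open Summit.QuantumFields.BalabanUV.Beta.RootedMixedTableLaw (ent_X1_a ent_X2_a ent_X1_ap ent_Xc_ap ite_entry)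
open Summit.QuantumFields.BalabanUV.Beta.MixedWardSiteLaw (dInd_smul_eq_sum rootComm_eq comm_smul_right ent_W4_a)
open Summit.QuantumFields.BalabanUV.Beta.BorderJetWard (βfar)
open Summit.QuantumFields.BalabanUV.Beta.SymBorderJetWard (symT2At_gauge)
open Summit.QuantumFields.BalabanUV.Beta.SymRootedT2JetAdditive (symT2At_sum_B symT2At_sub_B)
open Summit.QuantumFields.BalabanUV.Beta.SymWardSiteToBlock (symBondWardB_of_symSiteWardB)
open Summit.QuantumFields.BalabanUV.Beta.BorderWardSiteLaw (βfar_single comm_smul_left ent_B2)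

namespace Summit.QuantumFields.BalabanUV.Beta.SymBorderWardSiteLaw

/-! ## §1 Letters and two entries: the comb module's `βfar_single comm_smul_left ent_B2` BY NAME -/

/-! ## §2 The two single-assignment site laws of the sym border table `symVh2Tab` -/

section Tables

variable {d L : ℕ} (hL : (L : ℚ) ≠ 0)
include hL

open Classical in
/-- [folklore] **SITE LAW OF `symVh2Tab`, STENCIL IN THE FIRST BACKGROUND** (letters: stencil `E₀₁`, spectator `E₁₂`, fluctuation `E₂₃`):
`Σ_κ (s_sym(f;(κ,u−e_κ),h) − s_sym(f;(κ,u),h)) = (2(d!)²L^{2d})⁻¹·n_sym(f,h)·(2χ_r − χ_{h₊} − χ_{h₋})`. -/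
theorem symVh2Tab_siteWard₁ (ρ : Fin d → ℤ) (μ : Fin d) (y u : Fin d → ℤ) (f h : Bond d) :
    ∑ κ : Fin d, (symVh2Tab ρ L μ y f (κ, u - AffineAveraging.unitVec κ) h - symVh2Tab ρ L μ y f (κ, u) h)
      = ((2 : ℚ) * ((d ! : ℚ) ^ 2 * (L : ℚ) ^ (2 * d)))⁻¹ * symVhCountAt ρ L μ y f h
          * (2 * (if u = (L : ℤ) • y + ρ then (1 : ℚ) else 0)
              - (if u = h.2 + AffineAveraging.unitVec h.1 then (1 : ℚ) else 0) - (if u = h.2 then (1 : ℚ) else 0)) := by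
  have key := symT2At_gauge (𝕜 := ℚ) (𝔸 := UT) (fun z : Site d => if u = z then (1 : ℚ) else 0) (E 0 1) (Nat.cast_ne_zero.2 (Nat.factorial_ne_zero d)) hL two_ne_zero ρ
    (single f (E 2 3)) (single h (E 1 2)) μ y
  beta_reduce at key
  rw [dInd_smul_eq_sum, symT2At_sum_B (h2 := two_ne_zero), βfar_single, βg1_single, βg1_single, symVhUAt_single, symVhUAt_single, symVhUAt_single,
    symVhUAt_single, comm_smul_right, comm_smul_right, comm_smul_left, rootComm_eq] at key
  have k := congrFun (congrFun key 0) 3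
  simp only [symT2At_sub_B (h2 := two_ne_zero), Matrix.sum_apply, Matrix.sub_apply, Matrix.add_apply, Matrix.smul_apply, ent_W4_a, ent_Xc_ap,
    ent_X2_a] at k
  simp only [symVh2Tab]
  rw [k]
  simp only [smul_eq_mul, zsmul_eq_mul, mul_zero, mul_neg, mul_one]
  ring

open Classical in
/-- [folklore] **SITE LAW OF `symVh2Tab`, STENCIL IN THE SECOND BACKGROUND** (letters: spectator `E₀₁`, stencil `E₁₂`, fluctuation `E₂₃`):
`Σ_κ (s_sym(f;h,(κ,u−e_κ)) − s_sym(f;h,(κ,u))) = (2(d!)²L^{2d})⁻¹·n_sym(f,h)·(χ_{h₊} + χ_{h₋} − 2χ_{x_f})`. -/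
theorem symVh2Tab_siteWard₂ (ρ : Fin d → ℤ) (μ : Fin d) (y u : Fin d → ℤ) (f h : Bond d) :
    ∑ κ : Fin d, (symVh2Tab ρ L μ y f h (κ, u - AffineAveraging.unitVec κ) - symVh2Tab ρ L μ y f h (κ, u))
      = ((2 : ℚ) * ((d ! : ℚ) ^ 2 * (L : ℚ) ^ (2 * d)))⁻¹ * symVhCountAt ρ L μ y f h
          * ((if u = h.2 + AffineAveraging.unitVec h.1 then (1 : ℚ) else 0) + (if u = h.2 then (1 : ℚ) else 0)
              - 2 * (if u = f.2 then (1 : ℚ) else 0)) := by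
  have key := symT2At_gauge (𝕜 := ℚ) (𝔸 := UT) (fun z : Site d => if u = z then (1 : ℚ) else 0) (E 1 2) (Nat.cast_ne_zero.2 (Nat.factorial_ne_zero d)) hL two_ne_zero ρ
    (single f (E 2 3)) (single h (E 0 1)) μ y
  beta_reduce at key
  rw [dInd_smul_eq_sum, symT2At_sum_B (h2 := two_ne_zero), βfar_single, βg1_single, βg1_single, symVhUAt_single, symVhUAt_single, symVhUAt_single,
    symVhUAt_single, comm_smul_right, comm_smul_right, comm_smul_left, rootComm_eq] at key
  have k := congrFun (congrFun key 0) 3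
  simp only [symT2At_sub_B (h2 := two_ne_zero), Matrix.sum_apply, Matrix.sub_apply, Matrix.add_apply, Matrix.smul_apply, ent_X1_ap, ent_B2,
    ent_X1_a] at k
  have hs : ∀ g : Bond d, symVh2Tab ρ L μ y f h g = symT2At ℚ ρ (upF (single f (E 2 3))) (single g (E 1 2)) (single h (E 0 1)) L μ y 0 3 := by
    intro g; rw [symVh2Tab, symT2At_symm]
  simp only [hs]
  rw [k]
  simp only [smul_eq_mul, zsmul_eq_mul, mul_zero, sub_zero, mul_neg, mul_one]
  ring

end Tables

/-! ## §3 (W2-B)_sym in kernel currency -/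

section Kernels

variable {d : ℕ}

open Classical in
/-- [folklore] **an1's SITE-LEVEL BORDER WARD LAW (W2-B)_sym FOR THE SYM BORDER KERNEL — A THEOREM** (general `d`, any root `ρ`, `L ≠ 0`): the
½-symmetrisation of the two single-assignment laws is `m_sym,b(f,h)·([u = r_b] − [u = x_f])`, `m_sym,b = symVhKerAt = n_sym∕(2(d!)²L^{2d})`. -/
theorem symVh2KerAt_siteWard {L : ℕ} (hL : L ≠ 0) (ρ : Fin d → ℤ) (μ : Fin d) (y u : Fin d → ℤ) (f h : Bond d) :
    ∑ κ : Fin d,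
        ((1 / 2 : ℝ) * (symVh2KerAt ρ L μ y f (κ, u - AffineAveraging.unitVec κ) h + symVh2KerAt ρ L μ y f h (κ, u - AffineAveraging.unitVec κ))
          - (1 / 2 : ℝ) * (symVh2KerAt ρ L μ y f (κ, u) h + symVh2KerAt ρ L μ y f h (κ, u)))
      = symVhKerAt ρ L μ y f h * ((if u = (L : ℤ) • y + ρ then (1 : ℝ) else 0) - (if u = f.2 then (1 : ℝ) else 0)) := by
  have hLq : (L : ℚ) ≠ 0 := Nat.cast_ne_zero.2 hL
  have h₁ := congrArg (fun q : ℚ => (q : ℝ)) (symVh2Tab_siteWard₁ hLq ρ μ y u f h)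
  have h₂ := congrArg (fun q : ℚ => (q : ℝ)) (symVh2Tab_siteWard₂ hLq ρ μ y u f h)
  simp only [Rat.cast_sum, Rat.cast_sub, Rat.cast_add, Rat.cast_mul, Rat.cast_inv, Rat.cast_pow, Rat.cast_natCast, Rat.cast_intCast,
    Rat.cast_ofNat, apply_ite (Rat.cast : ℚ → ℝ), Rat.cast_one, Rat.cast_zero] at h₁ h₂
  have hs : ∀ κ : Fin d,
      (1 / 2 : ℝ) * (symVh2KerAt ρ L μ y f (κ, u - AffineAveraging.unitVec κ) h + symVh2KerAt ρ L μ y f h (κ, u - AffineAveraging.unitVec κ))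
        - (1 / 2 : ℝ) * (symVh2KerAt ρ L μ y f (κ, u) h + symVh2KerAt ρ L μ y f h (κ, u))
      = (1 / 2 : ℝ) * ((symVh2Tab ρ L μ y f (κ, u - AffineAveraging.unitVec κ) h : ℝ) - (symVh2Tab ρ L μ y f (κ, u) h : ℝ))
        + (1 / 2 : ℝ) * ((symVh2Tab ρ L μ y f h (κ, u - AffineAveraging.unitVec κ) : ℝ) - (symVh2Tab ρ L μ y f h (κ, u) : ℝ)) := by
    intro κ; simp only [symVh2KerAt]; ring
  rw [Finset.sum_congr rfl (fun κ _ => hs κ), Finset.sum_add_distrib, ← Finset.mul_sum, ← Finset.mul_sum, h₁, h₂, symVhKerAt, div_eq_mul_inv]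
  ring

end Kernels

/-! ## §4 `d = 4`, root `ctr 4 Lc`: the hypothesis of `SymWardSiteToBlock.symBondWardB_of_symSiteWardB` verbatim, and its discharge -/

section Row

variable {Lc : ℕ} [NeZero Lc]

open Classical in
/-- [folklore] **(W2-B)_sym AT `d = 4`, ROOT `ρ_c = ctr 4 Lc`** — the hypothesis `hS` of an1's `SymWardSiteToBlock.symBondWardB_of_symSiteWardB`, token
for token, a theorem. -/
theorem symSiteWardB :
    ∀ (u : Fin 4 → ℤ) (m : Fin 4) (y : Fin 4 → ℤ) (β : Fin 4) (x : Fin 4 → ℤ) (κ' : Fin 4) (u' : Fin 4 → ℤ),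
      ∑ κ : Fin (3 + 1),
          ((1 / 2 : ℝ) * (symVh2KerAt (ctr 4 Lc) Lc m y (β, x) (κ, u - B6BondElimination.unitVec κ) (κ', u')
              + symVh2KerAt (ctr 4 Lc) Lc m y (β, x) (κ', u') (κ, u - B6BondElimination.unitVec κ))
            - (1 / 2 : ℝ) * (symVh2KerAt (ctr 4 Lc) Lc m y (β, x) (κ, u) (κ', u')
              + symVh2KerAt (ctr 4 Lc) Lc m y (β, x) (κ', u') (κ, u))) =
        symVhKerAt (ctr 4 Lc) Lc m y (β, x) (κ', u')
          * ((if u = (Lc : ℤ) • y + ctr 4 Lc then (1 : ℝ) else 0) - (if u = x then (1 : ℝ) else 0)) := by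
  intro u m y β x κ' u'
  have hU : ∀ κ : Fin 4, (B6BondElimination.unitVec κ : Fin 4 → ℤ) = AffineAveraging.unitVec κ := fun κ => by
    funext i
    simp only [B6BondElimination.unitVec, AffineAveraging.unitVec, Pi.single_apply]
  simp only [hU]
  exact symVh2KerAt_siteWard (NeZero.ne Lc) (ctr 4 Lc) m y u (β, x) (κ', u')

/-- [folklore] **THE BORDER WARD BOND IDENTITY `hWb`_sym AT lockB `cB = −Lc¹²∕4` FOR THE SYM KERNELS** (`Lc` odd; the block sum
`SymWardSiteToBlock.symBondWardB_of_symSiteWardB` of `symSiteWardB`). -/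
theorem symBondWardB (hLc : Odd Lc) :
    ∀ (Y : Fin 4 → ℤ) (κ' : Fin 4) (u' x z : Fin 4 → ℤ) (β m : Fin 4), off Lc z = 0 →
      (stepScale 3 Lc 0 * (Lc : ℝ) ^ (3 + 1))⁻¹ *
          ∑ v ∈ box (3 + 1) Lc, ∑ κ : Fin (3 + 1),
            ((-((Lc : ℝ) ^ 12 / 4)) * ((1 / 2 : ℝ) * (symVh2KerAt (ctr 4 Lc) Lc m (blk Lc z) (β, x) (κ, (Lc : ℤ) • Y + toSite v - B6BondElimination.unitVec κ) (κ', u')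
                + symVh2KerAt (ctr 4 Lc) Lc m (blk Lc z) (β, x) (κ', u') (κ, (Lc : ℤ) • Y + toSite v - B6BondElimination.unitVec κ)))
              - (-((Lc : ℝ) ^ 12 / 4)) * ((1 / 2 : ℝ) * (symVh2KerAt (ctr 4 Lc) Lc m (blk Lc z) (β, x) (κ, (Lc : ℤ) • Y + toSite v) (κ', u')
                + symVh2KerAt (ctr 4 Lc) Lc m (blk Lc z) (β, x) (κ', u') (κ, (Lc : ℤ) • Y + toSite v)))) =
        (-((Lc : ℝ) ^ (3 + 1) * (1 / 2) * (Lc : ℝ) ^ (3 + 1))) * symVhKerAt (ctr 4 Lc) Lc m (blk Lc z) (β, x) (κ', u')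
            * ((1 / 2 : ℝ) * ∑ v ∈ box (3 + 1) Lc, (if z + ctr 4 Lc = (Lc : ℤ) • Y + toSite v then (1 : ℝ) else 0))
          - ((1 / 2 : ℝ) * ∑ v ∈ box (3 + 1) Lc, (if x = (Lc : ℤ) • Y + toSite v then (1 : ℝ) else 0))
            * ((-((Lc : ℝ) ^ (3 + 1) * (1 / 2) * (Lc : ℝ) ^ (3 + 1))) * symVhKerAt (ctr 4 Lc) Lc m (blk Lc z) (β, x) (κ', u')) :=
  symBondWardB_of_symSiteWardB hLc symSiteWardB

end Row

end Summit.QuantumFields.BalabanUV.Beta.SymBorderWardSiteLaw
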